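import Literature.MathematicalPhysics.KineticTheory.CollisionTubePullbackAssembly
import HarnessLib

/-!
# The collision-cylinder pull-back along hard-sphere orbits, VII: the pathwise theorem

The collision-side mismatch splits into the continuity correction plus `C_χ C_g` times the short-flight
deficit (`collisionMismatch_le`: one collision's `|κε w(s) − ∫_W w| ≤ ∫ |w(t) − w(s)| dt + deficit·|w(s)|`),
whence the PATHWISE CYLINDER PULL-BACK `cylinderPullback_pathwise`:
`|collisionSum − tubeTimeStat … 1 κ| ≤ ((N+1)κ)⁻¹ (continuityCorrection + C_χ C_g shortFlightDeficit)
+ C_χ C_g C_Ψ · ε/(N+1) · (2 threeBodyCollisionSum + pairShellCount (Φ_τ z))` along every good orbit.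
Gluing helpers for compositions: a jointly measurable bounded one-time functional is integrable in
time along good orbits (`integrableOn_orbit_of_measurable_bounded`), and the Enskog time-slicing
`evenStat − evenTubeTimeStat = collisionSum − tubeTimeStat` is exact under integrability
(`evenStat_sub_evenTubeTimeStat_eq`).

## References

* C. Cercignani, R. Illner, M. Pulvirenti, *The Mathematical Theory of Dilute Gases* (1994), §2.2
  (Boltzmann's collision cylinder: the molecules about to hit a given one within time `dt` fill the
  cylinder of height `|V · n| dt` over the protection sphere; pre-collisional hemisphere `V · n < 0`).
  [CIPDiluteGases1994]
* I. Gallagher, L. Saint-Raymond, B. Texier, *From Newton to Boltzmann* (2013), Part II Ch. 4, §4.1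
  (the hard-sphere flow: free flow between collisions, elastic reflection at `|xᵢ − xⱼ| = ε`,
  pre-collisional iff `νⁱʲ · (vᵢ − vⱼ) < 0`; Prop. 4.1.1, Def. 4.1.2). [GallagherSaintRaymondTexier2013]
-/

noncomputable section

open scoped BigOperators Classical InnerProductSpace ENNReal Topology
open Set MeasureTheory Filter Function
open Literature.Analysis.FluidPDE

namespace Literature.MathematicalPhysics.KineticTheory

/-! ## Splitting the collision-side mismatch: continuity correction and short-flight deficit -/

section MismatchSplit

variable {σ : ℝ} {N : ℕ} {Φ : HardSphereFlow (Torus.geometry (Fin 3)) (hsDiameter σ N) (N + 1)}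
  {z : Config (N + 1) (Fin 3) T3} {χ : ℝ × UnitAddTorus (Fin 3) → ℝ} {g : ℝ → ℝ}
  {Ψ : V3 × V3 × V3 → ℝ} {r κ τ Cχ Cg : ℝ}

/-- The weight along a good orbit is integrable on every subset of `[0, τ]`. [folklore] -/
theorem integrableOn_weightAt_orbit (hz : z ∈ Φ.good) (hχ : Continuous χ) (hg : Continuous g)
    (hχb : ∀ t ∈ Icc (0 : ℝ) τ, ∀ x, |χ (t, x)| ≤ Cχ) (hgb : ∀ a, 0 ≤ a → |g a| ≤ Cg) (hσ : 0 ≤ σ)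
    (hr : 0 < r) (i : Fin (N + 1)) {S : Set ℝ} (hS : S ⊆ Icc 0 τ) :
    IntegrableOn (fun t => weightAt σ N χ g r t (orbit σ N Φ z t) i) S := by
  have h1 := measurable_weightAt_uncurry (σ := σ) (r := r) hχ hg i
  have h2 : Measurable fun t : ℝ => (t, orbit σ N Φ z t) := measurable_id.prodMk (measurable_orbit hz)
  have hmeas : Measurable fun t => weightAt σ N χ g r t (orbit σ N Φ z t) i := by
    exact Measurable.comp (g := fun p : ℝ × Config (N + 1) (Fin 3) T3 => weightAt σ N χ g r p.1 p.2 i)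
      (f := fun t : ℝ => (t, orbit σ N Φ z t)) h1 h2
  refine IntegrableOn.mono_set ?_ hS
  refine IntegrableOn.of_bound measure_Icc_lt_top hmeas.aestronglyMeasurable (Cχ * Cg) ?_
  refine ae_restrict_of_forall_mem measurableSet_Icc fun t ht => ?_
  rw [Real.norm_eq_abs]
  exact abs_weightAt_le hχb hgb hσ hr ht _ i

/-- The length of the actual tube window `W = (p, s) ∩ [s − κε, ∞)` is `s − max(p, s − κε)`
(`p ≤ s`, `κ ε ≥ 0`). [folklore] -/
theorem volume_real_window {p s κε : ℝ} (hps : p ≤ s) (hκε : 0 ≤ κε) :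
    volume.real (Ioo p s ∩ Ici (s - κε)) = s - max p (s - κε) := by
  have hle : max p (s - κε) ≤ s := max_le hps (by linarith)
  apply le_antisymm
  · calc volume.real (Ioo p s ∩ Ici (s - κε)) ≤ volume.real (Icc (max p (s - κε)) s) :=
          measureReal_mono (fun t ht => ⟨max_le ht.1.1.le ht.2, ht.1.2.le⟩) measure_Icc_lt_top.ne
      _ = s - max p (s - κε) := Real.volume_real_Icc_of_le hle
  · calc s - max p (s - κε) = volume.real (Ioo (max p (s - κε)) s) := (Real.volume_real_Ioo_of_le hle).symm
      _ ≤ volume.real (Ioo p s ∩ Ici (s - κε)) :=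
          measureReal_mono (fun t ht => ⟨⟨(le_max_left _ _).trans_lt ht.1, ht.2⟩, (le_max_right _ _).trans ht.1.le⟩)
            ((measure_mono inter_subset_left).trans_lt measure_Ioo_lt_top).ne

/-- **One collision's mismatch splits** into the oscillation of the weight over the window and the
deficit of the window length: `|κε w(s) − ∫_W w| ≤ ∫_{[max(0,s−κε), s]} |w(t) − w(s)| dt +
(p − (s − κε))₊ |w(s)|` for `W = (p, s) ∩ [s − κε, ∞)`, `0 ≤ p ≤ s ≤ τ`. [folklore] -/
theorem abs_window_mismatch_le (hz : z ∈ Φ.good) (hχ : Continuous χ) (hg : Continuous g)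
    (hχb : ∀ t ∈ Icc (0 : ℝ) τ, ∀ x, |χ (t, x)| ≤ Cχ) (hgb : ∀ a, 0 ≤ a → |g a| ≤ Cg) (hσ : 0 ≤ σ)
    (hr : 0 < r) (hκε : 0 ≤ κ * hsDiameter σ N) (i : Fin (N + 1)) {p s : ℝ} (hp0 : 0 ≤ p) (hps : p ≤ s)
    (hsτ : s ≤ τ) :
    |κ * hsDiameter σ N * weightAt σ N χ g r s (orbit σ N Φ z s) i -
        ∫ t in Ioo p s ∩ Ici (s - κ * hsDiameter σ N), weightAt σ N χ g r t (orbit σ N Φ z t) i| ≤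
      (∫ t in Icc (max 0 (s - κ * hsDiameter σ N)) s,
          |weightAt σ N χ g r t (orbit σ N Φ z t) i - weightAt σ N χ g r s (orbit σ N Φ z s) i|) +
        max (p - (s - κ * hsDiameter σ N)) 0 * |weightAt σ N χ g r s (orbit σ N Φ z s) i| := by
  set W := Ioo p s ∩ Ici (s - κ * hsDiameter σ N) with hW
  set w := fun t => weightAt σ N χ g r t (orbit σ N Φ z t) i with hw
  have hWsub : W ⊆ Icc (max 0 (s - κ * hsDiameter σ N)) s := fun t ht =>
    ⟨max_le (hp0.trans ht.1.1.le) ht.2, ht.1.2.le⟩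
  have hIsub : Icc (max 0 (s - κ * hsDiameter σ N)) s ⊆ Icc 0 τ := fun t ht =>
    ⟨(le_max_left _ _).trans ht.1, ht.2.trans hsτ⟩
  have hvolW : volume W < ⊤ := (measure_mono inter_subset_left).trans_lt measure_Ioo_lt_top
  haveI : IsFiniteMeasure (volume.restrict W) := ⟨by rwa [Measure.restrict_apply_univ]⟩
  have hwI : IntegrableOn w W := integrableOn_weightAt_orbit hz hχ hg hχb hgb hσ hr i (hWsub.trans hIsub)
  have hcI : IntegrableOn (fun _ => w s) W := integrableOn_const hvolW.ne
  have hvol : volume.real W = s - max p (s - κ * hsDiameter σ N) := volume_real_window hps hκε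
  have hdef : κ * hsDiameter σ N - volume.real W = max (p - (s - κ * hsDiameter σ N)) 0 := by
    rw [hvol]
    rcases le_total p (s - κ * hsDiameter σ N) with h | h
    · rw [max_eq_right h, max_eq_right (by linarith)]; ring
    · rw [max_eq_left h, max_eq_left (by linarith)]; ring
  have hsplit : κ * hsDiameter σ N * w s - ∫ t in W, w t =
      (∫ t in W, (w s - w t)) + (κ * hsDiameter σ N - volume.real W) * w s := by
    rw [integral_sub hcI hwI, setIntegral_const, smul_eq_mul]
    ring
  rw [hsplit, hdef]
  refine (abs_add_le _ _).trans (add_le_add ?_ ?_)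
  · calc |∫ t in W, (w s - w t)| ≤ ∫ t in W, |w s - w t| := abs_integral_le_integral_abs
      _ = ∫ t in W, |w t - w s| := by simp_rw [abs_sub_comm]
      _ ≤ ∫ t in Icc (max 0 (s - κ * hsDiameter σ N)) s, |w t - w s| := by
          refine setIntegral_mono_set ?_ (ae_of_all _ fun t => abs_nonneg _) (ae_of_all _ hWsub)
          exact ((integrableOn_weightAt_orbit hz hχ hg hχb hgb hσ hr i hIsub).sub
            (integrableOn_const measure_Icc_lt_top.ne)).abs
  · rw [abs_mul, abs_of_nonneg (le_max_right _ _)]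

/-- **The collision-side mismatch is bounded by the continuity correction plus `C_χ C_g` times the
short-flight deficit**, along every good orbit. [folklore] -/
theorem collisionMismatch_le (hz : z ∈ Φ.good) (hχ : Continuous χ) (hg : Continuous g)
    (hχb : ∀ t ∈ Icc (0 : ℝ) τ, ∀ x, |χ (t, x)| ≤ Cχ) (hgb : ∀ a, 0 ≤ a → |g a| ≤ Cg) (hσ : 0 ≤ σ)
    (hr : 0 < r) (hκ : 0 ≤ κ) :
    collisionMismatch σ N Φ τ χ g Ψ r κ z ≤
      continuityCorrection σ N Φ τ χ g Ψ r κ z + Cχ * Cg * shortFlightDeficit σ N Φ τ Ψ κ z := by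
  have hfin : (collisionTimes (Torus.geometry (Fin 3)) (hsDiameter σ N) (orbit σ N Φ z) ∩ Icc 0 τ).Finite :=
    (isTraj hz).locFinite 0 τ
  have hε0 : 0 ≤ hsDiameter σ N := by
    unfold hsDiameter
    exact mul_nonneg hσ (Real.rpow_nonneg (by positivity) _)
  have hκε : 0 ≤ κ * hsDiameter σ N := mul_nonneg hκ hε0
  unfold collisionMismatch continuityCorrection shortFlightDeficit
  rw [← collisionPairSum_const_mul hfin, ← collisionPairSum_add hfin]
  refine collisionPairSum_mono hfin fun s hs e _ => ?_
  have hsI : s ∈ Icc 0 τ := hs.2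
  have hps : pairFlightStart σ N Φ z e.1 e.2 s ≤ s := by
    rcases hsI.1.lt_or_eq with h0 | h0
    · exact (pairFlightStart_lt hz e.1 e.2 h0).le
    · rcases pairFlightStart_eq_zero_or hz e.1 e.2 s with h | ⟨h, -⟩
      · rw [h, ← h0]
      · exact h.2.le
  have hmain := abs_window_mismatch_le hz hχ hg hχb hgb hσ hr hκε e.1 (pairFlightStart_nonneg hz e.1 e.2 s) hps hsI.2
  have hw := abs_weightAt_le hχb hgb hσ hr hsI (orbit σ N Φ z s) e.1
  have hcm : 0 ≤ |collMark σ N Ψ (orbit σ N Φ z s) e.1 e.2| := abs_nonneg _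
  have hd : 0 ≤ max (pairFlightStart σ N Φ z e.1 e.2 s - (s - κ * hsDiameter σ N)) 0 := le_max_right _ _
  calc |collMark σ N Ψ (orbit σ N Φ z s) e.1 e.2| *
        |κ * hsDiameter σ N * weightAt σ N χ g r s (orbit σ N Φ z s) e.1 -
          ∫ t in Ioo (pairFlightStart σ N Φ z e.1 e.2 s) s ∩ Ici (s - κ * hsDiameter σ N),
            weightAt σ N χ g r t (orbit σ N Φ z t) e.1|
      ≤ |collMark σ N Ψ (orbit σ N Φ z s) e.1 e.2| *
        ((∫ t in Icc (max 0 (s - κ * hsDiameter σ N)) s,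
            |weightAt σ N χ g r t (orbit σ N Φ z t) e.1 - weightAt σ N χ g r s (orbit σ N Φ z s) e.1|) +
          max (pairFlightStart σ N Φ z e.1 e.2 s - (s - κ * hsDiameter σ N)) 0 * (Cχ * Cg)) := by
        refine mul_le_mul_of_nonneg_left (hmain.trans (add_le_add le_rfl ?_)) hcm
        exact mul_le_mul_of_nonneg_left hw hd
    _ = _ := by ring

end MismatchSplit

/-! ## Gluing helpers for the composition: integrability along good orbits and the exact Enskog slicing -/

section Gluing

variable {σ : ℝ} {N : ℕ} {Φ : HardSphereFlow (Torus.geometry (Fin 3)) (hsDiameter σ N) (N + 1)}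
  {z : Config (N + 1) (Fin 3) T3}

/-- **A jointly measurable, uniformly bounded one-time functional is integrable in time along every
good orbit** (the orbit is Borel measurable in time). [folklore] -/
theorem integrableOn_orbit_of_measurable_bounded (hz : z ∈ Φ.good) {τ B : ℝ}
    {X : ℝ → Config (N + 1) (Fin 3) T3 → ℝ} (hX : Measurable fun p : ℝ × Config (N + 1) (Fin 3) T3 => X p.1 p.2)
    (hB : ∀ t ∈ Icc (0 : ℝ) τ, ∀ ζ : Config (N + 1) (Fin 3) T3, |X t ζ| ≤ B) :
    IntegrableOn (fun t => X t (Φ.flow t z)) (Icc 0 τ) := by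
  have h2 : Measurable fun t : ℝ => (t, orbit σ N Φ z t) := measurable_id.prodMk (measurable_orbit hz)
  have hmeas : Measurable fun t => X t (Φ.flow t z) := by
    exact Measurable.comp (g := fun p : ℝ × Config (N + 1) (Fin 3) T3 => X p.1 p.2)
      (f := fun t : ℝ => (t, orbit σ N Φ z t)) hX h2
  refine IntegrableOn.of_bound measure_Icc_lt_top hmeas.aestronglyMeasurable B ?_
  refine ae_restrict_of_forall_mem measurableSet_Icc fun t ht => ?_
  rw [Real.norm_eq_abs]
  exact hB t ht _

/-- **The Enskog slicing is exact** whenever both one-time functionals are integrable in time along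
the orbit: `evenStat − evenTubeTimeStat = collisionSum − tubeTimeStat … 1 κ` (the time integrals of
the Enskog rate functional cancel). [folklore] -/
theorem evenStat_sub_evenTubeTimeStat_eq {τ : ℝ} {χ : ℝ × UnitAddTorus (Fin 3) → ℝ} {g : ℝ → ℝ}
    {Ξ : V3 × V3 × V3 → ℝ} {r κ : ℝ} (z : Config (N + 1) (Fin 3) T3)
    (hA : IntegrableOn (fun t => tubeStat σ N χ g Ξ r r 1 κ t (Φ.flow t z)) (Icc 0 τ))
    (he : IntegrableOn (fun t => enskogRate σ N χ g Ξ r t (Φ.flow t z)) (Icc 0 τ)) :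
    evenStat σ N Φ τ χ g Ξ r z - evenTubeTimeStat σ N Φ τ χ g Ξ r κ z =
      Literature.MathematicalPhysics.KineticTheory.collisionSum σ N Φ τ χ g Ξ r z -
        tubeTimeStat σ N Φ τ χ g Ξ r r 1 κ z := by
  rw [evenStat_def, evenTubeTimeStat_def, tubeTimeStat_def]
  simp_rw [evenTubeStat_def]
  rw [integral_sub hA (he.const_mul _), integral_const_mul]
  ring

end Gluing

/-! ## The pathwise cylinder pull-back, explicit form -/

/-- **THE PATHWISE CYLINDER PULL-BACK.**  Along the orbit of a good initial
datum `z` of a hard-sphere flow `Φ` on `𝕋³` (`N + 1` spheres of diameter `ε = hsDiameter σ N`,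
`σ > 0`), for continuous marks `χ, g, Ψ` bounded by `C_χ` (on `[0, τ] × 𝕋³`), `C_g` (on `[0, ∞)`),
`C_Ψ`, with `Ψ(n, v, w) = 0` whenever `‖w − v‖ ≥ 2L` (`L ≥ 0`), and a flight-time parameter `κ > 0`
with `ε (1 + 2 L κ) < 1/2`:
`|K_N[χ g Ψ](z) − ∫₀^τ A_t(Φ_t z) dt| ≤ ((N+1)κ)⁻¹ (R_cont(z) + C_χ C_g R_short(z))`
`+ C_χ C_g C_Ψ · ε/(N+1) · (2 N₃(z) + P(Φ_τ z))`, where `K_N = collisionSum`,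
`∫₀^τ A_t = tubeTimeStat σ N Φ τ χ g Ψ r ϑ 1 κ` (tube functional at truncation level `1`),
`R_cont = continuityCorrection`, `R_short = shortFlightDeficit`, `N₃ = threeBodyCollisionSum`,
`P = pairShellCount` — explicit functionals of the orbit defined in this file. [folklore] -/
theorem cylinderPullback_pathwise :
    ∀ (σ : ℝ) (N : ℕ) (Φ : HardSphereFlow (Torus.geometry (Fin 3)) (hsDiameter σ N) (N + 1))
      (τ : ℝ) (χ : ℝ × UnitAddTorus (Fin 3) → ℝ) (g : ℝ → ℝ) (Ψ : V3 × V3 × V3 → ℝ)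
      (r ϑ κ L Cχ Cg CΨ : ℝ) (z : Config (N + 1) (Fin 3) T3),
      z ∈ Φ.good → 0 < σ → 0 < τ → 0 < r → 0 < κ → 0 ≤ L →
      hsDiameter σ N * (1 + 2 * L * κ) < 1 / 2 →
      Continuous χ → Continuous g → Continuous Ψ →
      (∀ t ∈ Set.Icc (0 : ℝ) τ, ∀ x, |χ (t, x)| ≤ Cχ) → (∀ a, 0 ≤ a → |g a| ≤ Cg) →
      (∀ p, |Ψ p| ≤ CΨ) → (∀ n v w : V3, 2 * L ≤ ‖w - v‖ → Ψ (n, v, w) = 0) →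
      |Literature.MathematicalPhysics.KineticTheory.collisionSum σ N Φ τ χ g Ψ r z -
          tubeTimeStat σ N Φ τ χ g Ψ r ϑ 1 κ z| ≤
        ((N + 1 : ℝ) * κ)⁻¹ *
            (continuityCorrection σ N Φ τ χ g Ψ r κ z + Cχ * Cg * shortFlightDeficit σ N Φ τ Ψ κ z) +
          Cχ * Cg * CΨ * (hsDiameter σ N / (N + 1 : ℝ)) *
            (2 * threeBodyCollisionSum σ N Φ τ L κ z + pairShellCount σ N L κ (Φ.flow τ z)) := by
  intro σ N Φ τ χ g Ψ r ϑ κ L Cχ Cg CΨ z hz hσ hτ hr hκ hL hsmall hχ hg hΨc hχb hgb hΨb hΨ0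
  have hN : (0 : ℝ) < N + 1 := by exact_mod_cast Nat.succ_pos N
  have hc : 0 ≤ ((N + 1 : ℝ) * κ)⁻¹ := (inv_pos.2 (mul_pos hN hκ)).le
  have h1 := collisionSum_sub_integral_tubeStat_le hz hσ hκ hL hsmall hτ hr hχ hg hΨc hχb hgb hΨb hΨ0 ϑ
  have h2 := collisionMismatch_le (Ψ := Ψ) (τ := τ) hz hχ hg hχb hgb hσ.le hr hκ.le
  rw [tubeTimeStat_def]
  exact h1.trans (add_le_add (mul_le_mul_of_nonneg_left h2 hc) le_rfl)

end Literature.MathematicalPhysics.KineticTheory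

end
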